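import Summits.QuantumFields.YangMills.Theorems.BalabanUVNodesN15KingModelBoxFineLayers
import Summits.QuantumFields.YangMills.Theorems.BalabanUVNodesN15KingModelBoxTransport
import Summits.QuantumFields.YangMills.Theorems.BalabanUVNodesN15KingModelRungUnit
import HarnessLib

/-!
# BalabanUVNodes ∕ N15 — THE KING-MODEL RUNG (PART Ν-l): KING's ACTUAL REGION `Ω_m = {0,…,L^m−1}^{d+1}` — ITS DOUBLED TORUS IS THE KING-VOLUME TORUS `Π ℤ∕2L^m`
# OF THIS LINEAGE's RUNG (`kingVol L j = dblPer (kingBoxSide L j)`, `rfl`), SO THE g0 TORUS THEOREMS FOLD ONTO `Ω_m`: NE2's unit-layer `η`-rate by the rung's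
# names, blocks fold like sites, and ★★★ KING's TOP PIECE `G^η_{(K)}` ON `Ω_m` (Neumann b.c., fine box of side `L^{K+m}`) DECAYS AT KING's TORUS RATE IN THE
# BLOCK DISTANCE, UNIFORMLY IN `K` AND `m`, AND ITS `η`-RATE IS THE TORUS ONE (`King1986.TopScalePiece.topPiece_decay_blocks` ∕ `topPiece_rate_blocks` folded)
# (Track A, DAG node N15 = NE2; FAN-OUT v1.1 §N15 s3 «KING-MODEL RUNG»: NE2's analogue decided in the model — its covariance piece on King's region; count-neutral)

HONEST FRAMING.  Count-neutral (cell `pub-ymgap`, seat `pub-ymgap-dag-n15-e` g39; `--supports stmt-QuantumFields-27366 --as helper` = K3⁸).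
TEMPLATE LITERATURE: C. King, Commun. Math. Phys. **102** (1986) 649–677 [King1986] §4 p.670 l.8–13 (verbatim in parts Ν-a∕c∕d∕f v1.1): the
Ω-propagators `G^η_k(Ω)` are multiple-reflection sums, after [Ba 4] = [Balaban1983RegularityDecay] (2.42), of the operator with free boundary conditions,
«as long as Ω is a rectangular parallelepiped which is a union of blocks of L^k sites», «so it is sufficient to prove Propositions 3.8 and 3.9 for the
operator with free boundary conditions»; Prop. 3.8 (3.71) p.664 and (4.44)–(4.45) p.675 (the top piece `G^η_{(K)} = C^η − G^η_K` and its decay).  The g0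
rung of this seat typed King's estimates on the King-volume tori `kingVol L j = (2L^m)_μ` (`…KingModelRung`: `topPiece_step_le`, `…RungUnit`: `blockCov_step_le`);
PART Ν (parts Ν-a…Ν-k) typed the doubled-TORUS (periodized) form of the multiple reflection method — a device of these files, ERRATUM-Ν1 — for every box.
THIS FILE makes the junction: (§1) the King-volume torus IS the doubled torus of King's region `Ω_m = {0,…,L^m−1}^{d+1}` (`kingVol_eq_dblPer`, by `rfl`), so every
torus statement of the rung folds onto `Ω_m` with Neumann («free») boundary conditions; (§2) by the rung's NAMES: ★★★ **`kingRegion_blockCovStep_le`** —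
`|fold(blockCovStep L a m² j)(s,t)| ≤ 2^{d+1}·C_diff·L^{−K}·e^{−(κ_M∕2)·d_Ω(s,t)}` (NE2's unit-layer `η`-rate on `Ω_m` = g0's `blockCov_step_le` folded; cf. part
Ν-i for general boxes), ★ `kingRegion_topPieceStep_le` (the image sum of the rung's base-point readout kernel `topPieceStep` inherits `topPiece_step_le` × 2^{d+1};
a transported readout, not the box top piece itself); (§3) BLOCKS FOLD LIKE SITES: for the fine box `Π Fin (N·L^m)` (`N = L^K` fine points per block side)
the King block of the image `σ_S(dblBox t)` (read on King's fine torus through part Ν-k's `toKing`) is the image `σ_S(dblBox B(t))` in the doubled UNIT torus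
(`blockOf_toKing_torReflS_dblBox`; `(2Nn−1−t)∕N = 2n−1−t∕N`), hence every torus bound in the BLOCK sup-distance transfers to the fine box (★★
`abs_foldOp_fromKing_le_exp_blocks`, using part Ν-c's `tdistT_dblBox_le_image` at the unit level); (§4) ★★★ **`kingRegion_topPiece_decay`** — with the
tree's `King1986.TopScalePiece.topPiece_decay_blocks` (King Prop. 3.8∕(4.45) on the tori of record, `L` odd, `a, m² > 0`): there are `δ, c > 0` (functions
of `d, L, a, m²`) such that for EVERY index `j = (m, K ≥ 1, …)` and all fine points `x, y` of `Ω_η = {0,…,L^{K+m}−1}^{d+1}`,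
`|fold(G^η_{(K)})(x,y)| ≤ 2^{d+1}·c·e^{−δ·tdistT_{T(2L^m)}(dblBox B(x), dblBox B(y))}` — NE2's covariance piece on King's actual region, with Neumann boundary
conditions, decays at King's torus rate, uniformly in the level `K` and the volume `L^m`; (§5) ★★★ **`kingRegion_topPiece_rate`** — with the tree's
`King1986.TopScalePiece.topPiece_rate_blocks` («Proposition 3.9 holds for G^η_{(K)}», p.675): for fine points `x′, y′` of `Ω` at spacing `L^{−K−n}` over `x, y` at
spacing `L^{−K}` (`x_μ = ⌊x′_μ∕L^n⌋`), `|fold(G^η_{(K),(n)})(x′,y′) − fold(G^η_{(K)})(x,y)| ≤ 2^{d+1}·(c√((C₁′+C₂′)(L^K)^{−γ}) + c·L^{−K})·e^{−δ·d_Ω(B(x),B(y))}` —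
THE `η`-RATE OF NE2's COVARIANCE PIECE ON KING's REGION (the floor relation survives every reflection, `val_toKing_image_div`, so the two image sums are
compared image by image).  With part Ν-i (unit layer) and §2, all three layers of the g0 rung's `n15_kingModelRung` now have their box form on `Ω_m`.
NOT Bałaban's covariant objects; NOT a node discharge (N15 is booked through n15-a's knit, untouched; the typed NE2 predicates stay on the torus carriers of
this lineage); `fold(G^η_{(K)})` is the doubled-torus image sum of these files ([Ba 4] (2.42) periodized), whose identification with King's printed
`G^η_k(Ω)` via the infinite-lattice series is NOT proved here (door (t2⁴²)); nothing continuum-YM ∕ `ℝ⁴` ∕ OS axioms ∕ Clay.  0 `sorry`.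

OBJECTS (data).  `kingBoxSide L j := (L^m)_μ` (King's region as a unit box), `boxBlockOf N n′ : KingBox (fine N n′) → KingBox n′` (`⌊t_μ∕N⌋`).

WHAT THIS FILE PROVES (kernel).  §1 `kingBoxSide_neZero`, ★ `kingVol_eq_dblPer` (`rfl`).  §2 ★★★ **`kingRegion_blockCovStep_le`**, ★ `kingRegion_topPieceStep_le`.  §3 `val_boxBlockOf`,
`mirror_div`, ★ `blockOf_toKing_torReflS_dblBox`, `blockOf_toKing_dblBox`, ★★ `abs_foldOp_fromKing_le_exp_blocks`.  §4 ★★★ **`kingRegion_topPiece_decay`**.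
§5 ★ `val_toKing_image_div`, ★★★ **`kingRegion_topPiece_rate`**.

HONEST SCOPE.  `L` odd, `L ≥ 2` (so `L ≥ 3`) and `a, m² > 0` where the tree's King theorems are used; `kingVol = 2L^m` per direction (the rung's tori); `0 ≤ γ ≤ 1` in §5.  King's `A = 0` scalar
model; the rate constants are the torus ones of `topPiece_rate_blocks` verbatim; N15 untouched; counts unmoved.  Locators: [King1986] §4 p.670 l.8–13, Prop. 3.8
(3.71) p.664, Prop. 3.9 (3.73) p.665, p.675 («Proposition 3.9 holds for G^η_{(K)}»), (4.39)–(4.41) pp.674–675,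
(4.44)–(4.45) p.675, p.664 (blocks); [Balaban1983RegularityDecay] (2.42) p.584.
-/

noncomputable section

open scoped BigOperators symmDiff
open Finset Matrix

namespace Summit.QuantumFields.YangMills.BalabanUVNodes.N15KingModelRung.TorusSpectral

open Literature.MathematicalPhysics.QuantumFieldTheory.Balaban1983to89.B5Prop11Plancherel (Tor fine unitVec)
open Literature.MathematicalPhysics.QuantumFieldTheory.King1986 (aK aK_pos prop38RateConst prop38PosConst lemma43Const)
open Literature.MathematicalPhysics.QuantumFieldTheory.King1986.Torus
open Summit.QuantumFields.YangMills.BalabanUVNodes.N15KingModelRung (KingVolIndex kingVol kingVol_neZero kingVol_eq_sitesPerDir blockCovStep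
  blockCov_step_le topPieceStep topPiece_step_le)

variable {d : ℕ}

/-! ## §1 King's region `Ω_m = {0,…,L^m−1}^{d+1}` and its doubled torus = the King-volume torus `Π ℤ∕2L^m` of this lineage's rung -/

section KingRegion

variable (L : ℕ) [NeZero L]

/-- KING's REGION as a unit box: side `L^m` in every direction (`L^m` unit blocks per side). [cite: King1986, §4 p.670 («a rectangular parallelepiped which is a union of
blocks»)] -/
def kingBoxSide (j : KingVolIndex d) : Fin (d + 1) → ℕ := fun _ => L ^ j.m

/-- The sides are nonzero. [folklore] -/
theorem kingBoxSide_neZero (j : KingVolIndex d) : ∀ μ, NeZero (kingBoxSide L j μ) := fun _ => ⟨pow_ne_zero _ (NeZero.ne L)⟩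

omit [NeZero L] in
/-- ★ **THE KING-VOLUME TORUS OF THE RUNG IS THE DOUBLED TORUS OF KING's REGION**: `kingVol L j = (2L^m)_μ = dblPer (kingBoxSide L j)` — definitionally. [folklore] -/
theorem kingVol_eq_dblPer (j : KingVolIndex d) : kingVol L j = dblPer (kingBoxSide L j) := rfl

end KingRegion

/-! ## §2 NE2's unit layer and the base-point readout of the top piece on King's region, by the names of the g0 rung -/

section UnitLayer

variable (L : ℕ) [NeZero L]

/-- ★★★ **NE2's UNIT-LAYER `η`-RATE ON KING's REGION `Ω_m`, BY THE NAMES OF THE g0 RUNG**: the image sum (fold) of the rung's `η`-difference kernel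
`blockCovStep L a m² j = (Δ^{(K+1)})⁻¹ − (Δ^{(K)})⁻¹` of the King-volume torus `Π ℤ∕2L^m` — i.e. the difference of the two RG block-field covariances on the box
`Ω_m` with Neumann («free») boundary conditions (parts Ν-g∕Ν-i) — obeys `|fold(blockCovStep)(s,t)| ≤ 2^{d+1}·C_diff·L^{−K}·e^{−(κ_M∕2)·d_Ω(s,t)}`: the rung's
`blockCov_step_le` (g0) folded through part Ν-f's transport. [cite: King1986, (4.39)–(4.41) pp.674–675, §4 p.670] -/
theorem kingRegion_blockCovStep_le (hL : 2 ≤ L) {a m2 : ℝ} (ha : 0 < a) (hm : 0 < m2) (j : KingVolIndex d)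
    (s t : KingBox (kingBoxSide L j)) :
    haveI := kingBoxSide_neZero L j
    |foldOp (kingBoxSide L j) (fun b b' => blockCovStep L a m2 j b b') s t|
      ≤ 2 ^ (d + 1) * (CdiffM (d + 1) a m2 L * ((L : ℝ) ^ j.K)⁻¹
          * Real.exp (-(kapM (d + 1) a m2 L / 2 * tdistT (dblPer (kingBoxSide L j)) (dblBox (kingBoxSide L j) s) (dblBox (kingBoxSide L j) t)))) := by
  haveI := kingBoxSide_neZero L j
  have hC : 0 ≤ CdiffM (d + 1) a m2 L * ((L : ℝ) ^ j.K)⁻¹ := mul_nonneg (CdiffM_nonneg ha hm hL) (by positivity)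
  have hκ : 0 ≤ kapM (d + 1) a m2 L / 2 := by have := (kapM_pos_le (d := d + 1) ha hm hL).1; positivity
  refine abs_foldOp_le_exp_of_torusDecay (kingBoxSide L j) _ hC hκ (fun b b' => ?_) s t
  exact blockCov_step_le L hL ha hm j b b'

/-- ★ The image sum of the rung's BASE-POINT readout `topPieceStep L a m² j` of the top piece's `η`-difference (a kernel on the unit torus `Π ℤ∕2L^m`) obeys the
rung's bound `topPiece_step_le` (g0) with constant `× 2^{d+1}` on King's region: `|fold(topPieceStep)(s,t)| ≤ 2^{d+1}·C·e^{−δ·d_Ω(s,t)}·L^{−γK∕2}` — the transport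
needs no reflection symmetry.  (The box top piece itself is part Ν-k's fine-level fold; this is the transported readout kernel.) [cite: King1986, Prop. 3.9 (3.73) p.665, p.675] -/
theorem kingRegion_topPieceStep_le (hLodd : Odd L) (hL : 2 ≤ L) {a m2 : ℝ} (ha : 0 < a) (hm : 0 < m2) {γ : ℝ} (hγ0 : 0 < γ) (hγ1 : γ ≤ 1) :
    ∃ C δ : ℝ, 0 < C ∧ 0 < δ ∧ ∀ (j : KingVolIndex d) (s t : KingBox (kingBoxSide L j)),
      haveI := kingBoxSide_neZero L j
      |foldOp (kingBoxSide L j) (fun b b' => topPieceStep L a m2 j b b') s t|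
        ≤ 2 ^ (d + 1) * (C * ((L : ℝ) ^ (-(γ / 2))) ^ j.K
            * Real.exp (-(δ * tdistT (dblPer (kingBoxSide L j)) (dblBox (kingBoxSide L j) s) (dblBox (kingBoxSide L j) t)))) := by
  obtain ⟨C, δ, hC, hδ, H⟩ := topPiece_step_le L hLodd hL ha hm hγ0 hγ1
  refine ⟨C, δ, hC, hδ, fun j s t => ?_⟩
  haveI := kingBoxSide_neZero L j
  haveI := kingVol_neZero L j
  have hC' : 0 ≤ C * ((L : ℝ) ^ (-(γ / 2))) ^ j.K := by positivity
  refine abs_foldOp_le_exp_of_torusDecay (kingBoxSide L j) _ hC' hδ.le (fun b b' => ?_) s t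
  have h := H j b b'
  calc |topPieceStep L a m2 j b b'| ≤ C * Real.exp (-(δ * tdistT (kingVol L j) b b')) * (((L : ℝ) ^ (-(γ / 2))) ^ j.K) := h
    _ = C * ((L : ℝ) ^ (-(γ / 2))) ^ j.K * Real.exp (-(δ * tdistT (dblPer (kingBoxSide L j)) b b')) := by
        have e : tdistT (kingVol L j) b b' = tdistT (dblPer (kingBoxSide L j)) b b' := rfl
        rw [e]; ring

end UnitLayer

/-! ## §3 Blocks fold like sites: the block-distance transport for fine kernels -/

section Blocks

variable (N : ℕ) [NeZero N] (n' : Fin (d + 1) → ℕ) [hn : ∀ μ, NeZero (n' μ)]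

/-- The unit block of a fine box point: `⌊t_μ∕N⌋` coordinatewise. [cite: King1986, p.664 (blocks `B^k(x)`)] -/
def boxBlockOf (t : KingBox (fine N n')) : KingBox n' :=
  fun μ => ⟨(t μ).val / N, Nat.div_lt_of_lt_mul (by have h := (t μ).isLt; simp only [fine] at h; exact h)⟩

omit [NeZero N] hn in
/-- `val (boxBlockOf t)_μ = t_μ ∕ N`. [folklore] -/
theorem val_boxBlockOf (t : KingBox (fine N n')) (μ : Fin (d + 1)) : (boxBlockOf N n' t μ).val = (t μ).val / N := rfl

omit [NeZero N] hn in
/-- Integer division under the mirror: `(2Nn − 1 − t)∕N = 2n − 1 − t∕N` for `t < Nn`. [folklore] -/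
theorem mirror_div {M n t : ℕ} (hM : 0 < M) (ht : t < M * n) : (2 * (M * n) - 1 - t) / M = 2 * n - 1 - t / M := by
  set q := t / M with hq
  set r := t % M with hr
  have hdiv : t = M * q + r := (Nat.div_add_mod t M).symm
  have hrM : r < M := Nat.mod_lt t hM
  have hqn : q < n := Nat.div_lt_of_lt_mul ht
  refine Nat.div_eq_of_lt_le ?_ ?_
  · have e : (2 * n - 1 - q) * M = 2 * (M * n) - M - M * q := by
      rw [tsub_mul, tsub_mul]; ring_nf
    rw [e]; omega
  · have e : (2 * n - 1 - q + 1) * M = 2 * (M * n) - M * q := by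
      have : 2 * n - 1 - q + 1 = 2 * n - q := by omega
      rw [this, tsub_mul]; ring_nf
    rw [e]; omega

/-- ★ **BLOCKS FOLD LIKE SITES**: the King block of the image `σ_S(dblBox t)` of a fine box point (read on King's fine torus) is the image `σ_S(dblBox(block of t))` in the
doubled UNIT torus. [cite: King1986, p.664, §4 p.670] -/
theorem blockOf_toKing_torReflS_dblBox (S : Finset (Fin (d + 1))) (t : KingBox (fine N n')) :
    blockOf N (dblPer n') (toKing N n' (torReflS (dblPer (fine N n')) S (dblBox (fine N n') t)))
      = torReflS (dblPer n') S (dblBox n' (boxBlockOf N n' t)) := by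
  funext μ
  apply ZMod.val_injective
  rw [val_blockOf, show (toKing N n' (torReflS (dblPer (fine N n')) S (dblBox (fine N n') t)) μ).val
      = (torReflS (dblPer (fine N n')) S (dblBox (fine N n') t) μ).val from val_torCongr _ _ μ]
  have hNpos : 0 < N := Nat.pos_of_ne_zero (NeZero.ne N)
  have ht := (t μ).isLt
  by_cases hμ : μ ∈ S
  · rw [val_torReflS_dblBox_of_mem (fine N n') hμ, val_torReflS_dblBox_of_mem n' hμ, val_boxBlockOf]
    simp only [fine] at ht ⊢
    exact mirror_div hNpos ht
  · rw [val_torReflS_dblBox_of_not_mem (fine N n') hμ, val_torReflS_dblBox_of_not_mem n' hμ, val_boxBlockOf]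

/-- The direct term: the King block of `dblBox t` is `dblBox(block of t)`. [folklore] -/
theorem blockOf_toKing_dblBox (t : KingBox (fine N n')) :
    blockOf N (dblPer n') (toKing N n' (dblBox (fine N n') t)) = dblBox n' (boxBlockOf N n' t) := by
  simpa using blockOf_toKing_torReflS_dblBox N n' ∅ t

/-- ★★ **BLOCK-DISTANCE TRANSPORT**: a torus bound in the BLOCK sup-distance, `|A(x,y)| ≤ C·e^{−δ·tdistT(B(x),B(y))}` on King's fine torus `Tor (fine N (2n′))`, gives
`|fold(A)(s,t)| ≤ 2^{d+1}·C·e^{−δ·tdistT(dblBox B(s), dblBox B(t))}` on the fine box — every image is at least as far in block distance too (part Ν-c at the unit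
level). [cite: King1986, §4 p.670, (4.45) p.675] -/
theorem abs_foldOp_fromKing_le_exp_blocks (A : Matrix (Tor (fine N (dblPer n'))) (Tor (fine N (dblPer n'))) ℝ) {C δ : ℝ} (hC : 0 ≤ C) (hδ : 0 ≤ δ)
    (hA : ∀ x y : Tor (fine N (dblPer n')),
      |A x y| ≤ C * Real.exp (-(δ * tdistT (dblPer n') (blockOf N (dblPer n') x) (blockOf N (dblPer n') y)))) (s t : KingBox (fine N n')) :
    |foldOp (fine N n') (fromKing N n' A) s t|
      ≤ 2 ^ (d + 1) * (C * Real.exp (-(δ * tdistT (dblPer n') (dblBox n' (boxBlockOf N n' s)) (dblBox n' (boxBlockOf N n' t))))) := by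
  unfold foldOp
  refine le_trans (Finset.abs_sum_le_sum_abs _ _) ?_
  have hterm : ∀ S : Finset (Fin (d + 1)),
      |fromKing N n' A (dblBox (fine N n') s) (torReflS (dblPer (fine N n')) S (dblBox (fine N n') t))|
        ≤ C * Real.exp (-(δ * tdistT (dblPer n') (dblBox n' (boxBlockOf N n' s)) (dblBox n' (boxBlockOf N n' t)))) := by
    intro S
    rw [fromKing_apply]
    refine le_trans (hA _ _) (mul_le_mul_of_nonneg_left ?_ hC)
    rw [Real.exp_le_exp, neg_le_neg_iff, blockOf_toKing_dblBox, blockOf_toKing_torReflS_dblBox]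
    exact mul_le_mul_of_nonneg_left (tdistT_dblBox_le_image n' S _ _) hδ
  calc ∑ S : Finset (Fin (d + 1)), |fromKing N n' A (dblBox (fine N n') s) (torReflS (dblPer (fine N n')) S (dblBox (fine N n') t))|
      ≤ ∑ _S : Finset (Fin (d + 1)), C * Real.exp (-(δ * tdistT (dblPer n') (dblBox n' (boxBlockOf N n' s)) (dblBox n' (boxBlockOf N n' t)))) :=
        Finset.sum_le_sum fun S _ => hterm S
    _ = 2 ^ (d + 1) * (C * Real.exp (-(δ * tdistT (dblPer n') (dblBox n' (boxBlockOf N n' s)) (dblBox n' (boxBlockOf N n' t))))) := by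
        rw [Finset.sum_const, Finset.card_univ, Fintype.card_finset, Fintype.card_fin, nsmul_eq_mul]
        push_cast; ring

end Blocks

/-! ## §4 The top piece on King's region decays at King's torus rate, uniformly in the level and the volume -/

section TopPiece

variable (L : ℕ) [NeZero L]

/-- ★★★ **NE2's COVARIANCE PIECE ON KING's ACTUAL REGION: the fold of King's top piece `G^η_{(K)} = C^η − G^η_K` onto the fine box `Ω_η = {0,…,L^{K+m}−1}^{d+1}`
(King's region `Ω_m` at spacing `η = L^{−K}`, Neumann («free») boundary conditions) DECAYS IN THE BLOCK DISTANCE AT KING's TORUS RATE, uniformly in `K ≥ 1`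
and `m`**: `|G^η_{(K),Ω}(x,y)| ≤ 2^{d+1}·c·e^{−δ·d_Ω(B(x),B(y))}` with the constants `δ, c > 0` of `King1986.TopScalePiece.topPiece_decay_blocks` (functions of `d, L, a, m²`;
`L` odd `≥ 3`, `a, m² > 0`) — the torus theorem of record folded through §3 (the King-volume torus `Π ℤ∕2L^m` IS the doubled torus of `Ω_m`, `kingVol_eq_dblPer`).
[cite: King1986, Prop. 3.8 (3.71) p.664, (4.44)–(4.45) p.675, §4 p.670] -/
theorem kingRegion_topPiece_decay (hLodd : Odd L) (hL : 2 ≤ L) {a m2 : ℝ} (ha : 0 < a) (hm : 0 < m2) :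
    ∃ δ c : ℝ, 0 < δ ∧ 0 < c ∧ ∀ (j : KingVolIndex d) (s t : KingBox (fine (L ^ j.K) (kingBoxSide L j))),
      haveI := kingBoxSide_neZero L j
      haveI := kingVol_neZero L j
      |foldOp (fine (L ^ j.K) (kingBoxSide L j))
          (fromKing (L ^ j.K) (kingBoxSide L j) (topPiece (L ^ j.K) (kingVol L j) (aK a L j.K) (((L ^ j.K : ℕ) : ℝ) ^ 2) m2)) s t|
        ≤ 2 ^ (d + 1) * (c * Real.exp (-(δ * tdistT (dblPer (kingBoxSide L j))
            (dblBox (kingBoxSide L j) (boxBlockOf (L ^ j.K) (kingBoxSide L j) s)) (dblBox (kingBoxSide L j) (boxBlockOf (L ^ j.K) (kingBoxSide L j) t))))) := by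
  obtain ⟨δ, c, hδ, hc, H⟩ := topPiece_decay_blocks (d + 1) L (Nat.succ_pos d) hLodd hL ha hm
  refine ⟨δ, c, hδ, hc, fun j s t => ?_⟩
  haveI := kingBoxSide_neZero L j
  haveI := kingVol_neZero L j
  refine abs_foldOp_fromKing_le_exp_blocks (L ^ j.K) (kingBoxSide L j) _ hc.le hδ.le (fun x y => ?_) s t
  exact H (j.params L hLodd hL) rfl rfl j.one_le_K (kingVol L j) (kingVol_eq_sitesPerDir L hLodd hL j) (L ^ j.K) rfl x y

end TopPiece


/-! ## §5 The `η`-rate of the top piece on King's region (two spacings) -/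

section TopPieceRate

variable (L : ℕ) [NeZero L]

/-- The floor relation between a fine point of `Ω` at spacing `L^{−K−n}` and its image at spacing `L^{−K}` is preserved by every multi-reflection of the doubled
tori: `val(σ_S dblBox t)_μ = val(σ_S dblBox t′)_μ ∕ L^n` whenever `t_μ = t′_μ ∕ L^n` (§3's `mirror_div`). [folklore] -/
theorem val_toKing_image_div {N N' : ℕ} (hN' : 0 < N') {nb : Fin (d + 1) → ℕ} [∀ μ, NeZero (nb μ)] [NeZero N] [NeZero (N' * N)]
    (S : Finset (Fin (d + 1))) (t : KingBox (fine N nb)) (t' : KingBox (fine (N' * N) nb)) (htt : ∀ μ, (t μ).val = (t' μ).val / N')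
    (μ : Fin (d + 1)) :
    (toKing N nb (torReflS (dblPer (fine N nb)) S (dblBox (fine N nb) t)) μ).val
      = (toKing (N' * N) nb (torReflS (dblPer (fine (N' * N) nb)) S (dblBox (fine (N' * N) nb) t')) μ).val / N' := by
  rw [show (toKing N nb (torReflS (dblPer (fine N nb)) S (dblBox (fine N nb) t)) μ).val = (torReflS (dblPer (fine N nb)) S (dblBox (fine N nb) t) μ).val
      from val_torCongr _ _ μ,
    show (toKing (N' * N) nb (torReflS (dblPer (fine (N' * N) nb)) S (dblBox (fine (N' * N) nb) t')) μ).val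
      = (torReflS (dblPer (fine (N' * N) nb)) S (dblBox (fine (N' * N) nb) t') μ).val from val_torCongr _ _ μ]
  have ht' := (t' μ).isLt
  by_cases hμ : μ ∈ S
  · rw [val_torReflS_dblBox_of_mem (fine N nb) hμ, val_torReflS_dblBox_of_mem (fine (N' * N) nb) hμ, htt]
    have ht'' : (t' μ).val < N' * (N * nb μ) := lt_of_lt_of_eq (t' μ).isLt (by show N' * N * nb μ = _; ring)
    generalize (t' μ).val = v at ht'' ⊢
    show 2 * (N * nb μ) - 1 - v / N' = (2 * (N' * N * nb μ) - 1 - v) / N'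
    rw [show N' * N * nb μ = N' * (N * nb μ) by ring]
    exact (mirror_div hN' ht'').symm
  · rw [val_torReflS_dblBox_of_not_mem (fine N nb) hμ, val_torReflS_dblBox_of_not_mem (fine (N' * N) nb) hμ, htt]

/-- ★★★ **THE `η`-RATE OF NE2's COVARIANCE PIECE ON KING's ACTUAL REGION** («Proposition 3.9 holds for G^η_{(K)}», p.675, folded onto `Ω_m`): with the tree's
`King1986.TopScalePiece.topPiece_rate_blocks` (`L` odd, `a, m² > 0`, `0 ≤ γ ≤ 1`) there are `δ, c > 0` such that for every index `j = (m, K ≥ 1, …)`, every `n ≥ 1`,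
and all fine points `x′, y′ ∈ {0,…,L^{K+n+m}−1}^{d+1}` over `x, y ∈ {0,…,L^{K+m}−1}^{d+1}` (`x_μ = ⌊x′_μ∕L^n⌋`):
`|fold(G^η_{(K),(n)})(x′,y′) − fold(G^η_{(K)})(x,y)| ≤ 2^{d+1}·(c√((C₁′+C₂′)(L^K)^{−γ}) + c·L^{−K})·e^{−δ·tdistT_{T(2L^m)}(dblBox B(x), dblBox B(y))}` — the two image sums are
compared IMAGE BY IMAGE (the floor relation survives every reflection, `val_toKing_image_div`), each pair at least as far as the direct one in block distance.
[cite: King1986, p.675 («Proposition 3.9 holds for G^η_{(K)}»), Prop. 3.8 (3.71) p.664, Prop. 3.9 (3.73) p.665, §4 p.670] -/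
theorem kingRegion_topPiece_rate (hLodd : Odd L) (hL : 2 ≤ L) {a m2 : ℝ} (ha : 0 < a) (hm : 0 < m2) {γ : ℝ} (hγ0 : 0 ≤ γ) (hγ1 : γ ≤ 1) :
    ∃ δ c : ℝ, 0 < δ ∧ 0 < c ∧ ∀ (j : KingVolIndex d) (n : ℕ) (_hn : 1 ≤ n)
      (s t : KingBox (fine (L ^ j.K) (kingBoxSide L j))) (s' t' : KingBox (fine (L ^ n * L ^ j.K) (kingBoxSide L j)))
      (_hss : ∀ μ, (s μ).val = (s' μ).val / L ^ n) (_htt : ∀ μ, (t μ).val = (t' μ).val / L ^ n),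
      haveI := kingBoxSide_neZero L j
      haveI := kingVol_neZero L j
      |foldOp (fine (L ^ n * L ^ j.K) (kingBoxSide L j))
            (fromKing (L ^ n * L ^ j.K) (kingBoxSide L j)
              (topPiece (L ^ n * L ^ j.K) (kingVol L j) (aK a L (j.K + n)) (((L ^ n * L ^ j.K : ℕ) : ℝ) ^ 2) m2)) s' t'
          - foldOp (fine (L ^ j.K) (kingBoxSide L j))
            (fromKing (L ^ j.K) (kingBoxSide L j) (topPiece (L ^ j.K) (kingVol L j) (aK a L j.K) (((L ^ j.K : ℕ) : ℝ) ^ 2) m2)) s t|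
        ≤ 2 ^ (d + 1) * ((c * Real.sqrt ((prop38RateConst a a (lemma43Const a L j.K n) ((Real.pi ^ 2 / 4) ^ (d + 1)) (d + 1) γ
                + prop38PosConst a ((Real.pi ^ 2 / 4) ^ (d + 1)) (d + 1) γ) * ((L ^ j.K : ℕ) : ℝ) ^ (-γ)) + c * ((L : ℝ) ^ j.K)⁻¹)
            * Real.exp (-(δ * tdistT (dblPer (kingBoxSide L j))
                (dblBox (kingBoxSide L j) (boxBlockOf (L ^ j.K) (kingBoxSide L j) s))
                (dblBox (kingBoxSide L j) (boxBlockOf (L ^ j.K) (kingBoxSide L j) t))))) := by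
  obtain ⟨δ, c, hδ, hc, H⟩ := topPiece_rate_blocks (d + 1) L (Nat.succ_pos d) hLodd hL ha hm hγ0 hγ1
  refine ⟨δ, c, hδ, hc, fun j n hn s t s' t' hss htt => ?_⟩
  haveI := kingBoxSide_neZero L j
  haveI := kingVol_neZero L j
  have hLpos : 0 < L ^ n := pow_pos (Nat.pos_of_ne_zero (NeZero.ne L)) n
  set R : ℝ := c * Real.sqrt ((prop38RateConst a a (lemma43Const a L j.K n) ((Real.pi ^ 2 / 4) ^ (d + 1)) (d + 1) γ
      + prop38PosConst a ((Real.pi ^ 2 / 4) ^ (d + 1)) (d + 1) γ) * ((L ^ j.K : ℕ) : ℝ) ^ (-γ)) + c * ((L : ℝ) ^ j.K)⁻¹ with hR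
  have hR0 : 0 ≤ R := by positivity
  -- image by image
  unfold foldOp
  rw [← Finset.sum_sub_distrib]
  refine le_trans (Finset.abs_sum_le_sum_abs _ _) ?_
  have hterm : ∀ S : Finset (Fin (d + 1)),
      |fromKing (L ^ n * L ^ j.K) (kingBoxSide L j) (topPiece (L ^ n * L ^ j.K) (kingVol L j) (aK a L (j.K + n)) (((L ^ n * L ^ j.K : ℕ) : ℝ) ^ 2) m2)
            (dblBox (fine (L ^ n * L ^ j.K) (kingBoxSide L j)) s') (torReflS (dblPer (fine (L ^ n * L ^ j.K) (kingBoxSide L j))) S (dblBox _ t'))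
          - fromKing (L ^ j.K) (kingBoxSide L j) (topPiece (L ^ j.K) (kingVol L j) (aK a L j.K) (((L ^ j.K : ℕ) : ℝ) ^ 2) m2)
            (dblBox (fine (L ^ j.K) (kingBoxSide L j)) s) (torReflS (dblPer (fine (L ^ j.K) (kingBoxSide L j))) S (dblBox _ t))|
        ≤ R * Real.exp (-(δ * tdistT (dblPer (kingBoxSide L j))
            (dblBox (kingBoxSide L j) (boxBlockOf (L ^ j.K) (kingBoxSide L j) s))
            (dblBox (kingBoxSide L j) (boxBlockOf (L ^ j.K) (kingBoxSide L j) t)))) := by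
    intro S
    rw [fromKing_apply, fromKing_apply]
    have hxx : ∀ μ, (toKing (L ^ j.K) (kingBoxSide L j) (dblBox (fine (L ^ j.K) (kingBoxSide L j)) s) μ).val
        = (toKing (L ^ n * L ^ j.K) (kingBoxSide L j) (dblBox (fine (L ^ n * L ^ j.K) (kingBoxSide L j)) s') μ).val / L ^ n := by
      intro μ
      simpa using val_toKing_image_div hLpos ∅ s s' hss μ
    have hyy : ∀ μ, (toKing (L ^ j.K) (kingBoxSide L j) (torReflS (dblPer (fine (L ^ j.K) (kingBoxSide L j))) S (dblBox _ t)) μ).val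
        = (toKing (L ^ n * L ^ j.K) (kingBoxSide L j) (torReflS (dblPer (fine (L ^ n * L ^ j.K) (kingBoxSide L j))) S (dblBox _ t')) μ).val / L ^ n :=
      fun μ => val_toKing_image_div hLpos S t t' htt μ
    have h := H (j.params L hLodd hL) rfl rfl j.one_le_K n hn (kingVol L j) (kingVol_eq_sitesPerDir L hLodd hL j) _ _ _ _ hxx hyy
    refine le_trans h (mul_le_mul_of_nonneg_left ?_ hR0)
    rw [Real.exp_le_exp, neg_le_neg_iff]
    have e1 : blockOf (L ^ j.K) (kingVol L j) (toKing (L ^ j.K) (kingBoxSide L j) (dblBox (fine (L ^ j.K) (kingBoxSide L j)) s))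
        = dblBox (kingBoxSide L j) (boxBlockOf (L ^ j.K) (kingBoxSide L j) s) := blockOf_toKing_dblBox (L ^ j.K) (kingBoxSide L j) s
    have e2 : blockOf (L ^ j.K) (kingVol L j) (toKing (L ^ j.K) (kingBoxSide L j) (torReflS (dblPer (fine (L ^ j.K) (kingBoxSide L j))) S (dblBox _ t)))
        = torReflS (dblPer (kingBoxSide L j)) S (dblBox (kingBoxSide L j) (boxBlockOf (L ^ j.K) (kingBoxSide L j) t)) :=
      blockOf_toKing_torReflS_dblBox (L ^ j.K) (kingBoxSide L j) S t
    have e3 : tdistT (kingVol L j)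
          (blockOf (L ^ j.K) (kingVol L j) (toKing (L ^ j.K) (kingBoxSide L j) (dblBox (fine (L ^ j.K) (kingBoxSide L j)) s)))
          (blockOf (L ^ j.K) (kingVol L j) (toKing (L ^ j.K) (kingBoxSide L j) (torReflS (dblPer (fine (L ^ j.K) (kingBoxSide L j))) S (dblBox _ t))))
        = tdistT (dblPer (kingBoxSide L j)) (dblBox (kingBoxSide L j) (boxBlockOf (L ^ j.K) (kingBoxSide L j) s))
            (torReflS (dblPer (kingBoxSide L j)) S (dblBox (kingBoxSide L j) (boxBlockOf (L ^ j.K) (kingBoxSide L j) t))) := by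
      rw [e1, e2]; rfl
    rw [e3]
    exact mul_le_mul_of_nonneg_left (tdistT_dblBox_le_image (kingBoxSide L j) S _ _) hδ.le
  calc ∑ S : Finset (Fin (d + 1)), |_|
      ≤ ∑ _S : Finset (Fin (d + 1)), R * Real.exp (-(δ * tdistT (dblPer (kingBoxSide L j))
            (dblBox (kingBoxSide L j) (boxBlockOf (L ^ j.K) (kingBoxSide L j) s))
            (dblBox (kingBoxSide L j) (boxBlockOf (L ^ j.K) (kingBoxSide L j) t)))) := Finset.sum_le_sum fun S _ => hterm S
    _ = 2 ^ (d + 1) * (R * Real.exp (-(δ * tdistT (dblPer (kingBoxSide L j))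
            (dblBox (kingBoxSide L j) (boxBlockOf (L ^ j.K) (kingBoxSide L j) s))
            (dblBox (kingBoxSide L j) (boxBlockOf (L ^ j.K) (kingBoxSide L j) t))))) := by
        rw [Finset.sum_const, Finset.card_univ, Fintype.card_finset, Fintype.card_fin, nsmul_eq_mul]
        push_cast; ring

end TopPieceRate

end Summit.QuantumFields.YangMills.BalabanUVNodes.N15KingModelRung.TorusSpectral
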